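import Literature.AlgebraicGeometry.Frobenioids.MotivatingExamplesSub
import Literature.AlgebraicGeometry.Frobenioids.LogPrimesTranscendenceProofs
import Literature.AlgebraicGeometry.Frobenioids.LogPrimesLinearIndependent
import Mathlib.RingTheory.Ideal.Int
import Mathlib.NumberTheory.RamificationInertia.Inertia
import HarnessLib

/-!
# Frobenioids I, §6 sub-DAG — discharges, part 2: the numeric core of Theorem 6.4 (iii)

Proof-only companion of `MotivatingExamplesSub.lean` (Mochizuki, *The geometry of Frobenioids I*,
Kyushu J. Math. **62** (2008), §6, Thm. 6.4 (iii), proof p. 116 l. 4–16 [cite: MochizukiFrdI2008,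
Thm. 6.4 (iii) p.116]). Discharged here:
* the residue-characteristic bookkeeping of a finite place (`N(𝔭_w) = p^f`, `p = residueChar w` prime,
  `f ≥ 1`; every rational prime lies below some place; finitely many places above each prime);
* `Thm64iii_L04_threePairs` ("one verifies immediately that there exist three nonarchimedean valuations
  `w₁, w₃, w₅` … such that `p₁, …, p₆` are distinct", p. 116 l. 5–9) — pure combinatorics;
* `Thm64iii_L06_degRational` — the numeric core: `deg ∈ ℚ_{>0}` and each `w₁ ↦ w₂` lies over the same
  rational prime, from Lem. 6.5 (ii) (`Lemma65ii_holds`, abc-iut-L1-t3/L6-t10) and Lem. 6.5 (i)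
  (`linearIndependent_rat_log_primes`).
No statement of the paper is strengthened; nothing here bears on abc.
-/

noncomputable section

namespace Literature.AlgebraicGeometry.Frobenioids

open NumberField IsDedekindDomain Ideal

/-! ### Residue characteristics of finite places -/

section ResidueChar

variable {L : Type} [Field L] [NumberField L]

/-- `𝔭_w ∩ ℤ = (p)` with `p` prime (`p` = the positive generator `absNorm (𝔭_w ∩ ℤ)`). [folklore] -/
private theorem charBelow_prime (w : FinitePlace L) :
    (absNorm (under ℤ w.maximalIdeal.asIdeal)).Prime := by
  haveI : w.maximalIdeal.asIdeal.IsPrime := w.maximalIdeal.isPrime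
  haveI : NeZero w.maximalIdeal.asIdeal := ⟨w.maximalIdeal.ne_bot⟩
  exact Nat.absNorm_under_prime _

/-- `N(𝔭_w) = p^f` with `f ≠ 0`, `p = absNorm (𝔭_w ∩ ℤ)`. [folklore] -/
private theorem absNorm_eq_charBelow_pow (w : FinitePlace L) :
    ∃ f : ℕ, f ≠ 0 ∧
      absNorm w.maximalIdeal.asIdeal = absNorm (under ℤ w.maximalIdeal.asIdeal) ^ f := by
  have hp := charBelow_prime w
  haveI : w.maximalIdeal.asIdeal.LiesOver (span {(absNorm (under ℤ w.maximalIdeal.asIdeal) : ℤ)}) :=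
    Int.liesOver_span_absNorm _
  refine ⟨(span {(absNorm (under ℤ w.maximalIdeal.asIdeal) : ℤ)}).inertiaDeg' w.maximalIdeal.asIdeal, ?_,
    absNorm_eq_pow_inertiaDeg' _ hp⟩
  intro hf
  have h1 := NumberField.HeightOneSpectrum.one_lt_absNorm w.maximalIdeal
  rw [absNorm_eq_pow_inertiaDeg' _ hp, hf, pow_zero] at h1
  exact lt_irrefl _ h1

/-- **`N(𝔭_w) = p^f`, `p = residueChar w` prime, `f ≥ 1`** (Ex. 6.3 p. 112: `ord(O_v^▷) ≅ ℤ_{≥0}` and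
`deg^arith` maps its generator to `log #(O_v/(λ))`). [cite: MochizukiFrdI2008, Ex. 6.3 p.112] -/
theorem residueChar_spec (w : FinitePlace L) :
    (residueChar w).Prime ∧ ∃ f : ℕ, f ≠ 0 ∧ absNorm w.maximalIdeal.asIdeal = residueChar w ^ f := by
  obtain ⟨f, hf, hN⟩ := absNorm_eq_charBelow_pow w
  have hp := charBelow_prime w
  have hrc : residueChar w = absNorm (under ℤ w.maximalIdeal.asIdeal) := by
    unfold residueChar
    rw [hN, Nat.pow_minFac hf, hp.minFac_eq]
  rw [hrc]
  exact ⟨hp, f, hf, hN⟩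

/-- The residue characteristic is prime. [cite: MochizukiFrdI2008, Ex. 6.3 p.112] -/
theorem residueChar_prime (w : FinitePlace L) : (residueChar w).Prime := (residueChar_spec w).1

/-- `𝔭_w` lies over `(residueChar w)`. [cite: MochizukiFrdI2008, Ex. 6.3 p.112] -/
theorem liesOver_residueChar (w : FinitePlace L) :
    w.maximalIdeal.asIdeal.LiesOver (span {(residueChar w : ℤ)}) := by
  obtain ⟨f, hf, hN⟩ := absNorm_eq_charBelow_pow w
  have hp := charBelow_prime w
  have hrc : residueChar w = absNorm (under ℤ w.maximalIdeal.asIdeal) := by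
    unfold residueChar
    rw [hN, Nat.pow_minFac hf, hp.minFac_eq]
  rw [hrc]
  exact Int.liesOver_span_absNorm _

/-- `log N(𝔭_w) = f · log p` with `f ≥ 1`, `p = residueChar w`. [cite: MochizukiFrdI2008, Ex. 6.3 p.113] -/
theorem logNorm_eq (w : FinitePlace L) :
    ∃ f : ℕ, f ≠ 0 ∧ logNorm w = f * Real.log (residueChar w) := by
  obtain ⟨-, f, hf, hN⟩ := residueChar_spec w
  refine ⟨f, hf, ?_⟩
  simp only [logNorm, hN, Nat.cast_pow, Real.log_pow]

/-- If an ideal of `𝓞 L` is prime and lies over `(p)`, its absolute norm is a positive power of `p`, so its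
least prime factor is `p` (bookkeeping for "valuations lying over `v₀` of `ℚ`", p. 115).
[cite: MochizukiFrdI2008, Thm. 6.4 (iii) p.116] -/
theorem residueChar_eq_of_liesOver {p : ℕ} (hp : p.Prime) (w : FinitePlace L)
    [w.maximalIdeal.asIdeal.LiesOver (span {(p : ℤ)})] : residueChar w = p := by
  have hN := absNorm_eq_pow_inertiaDeg' w.maximalIdeal.asIdeal hp
  have hf : (span {(p : ℤ)}).inertiaDeg' w.maximalIdeal.asIdeal ≠ 0 := by
    intro hf
    have h1 := NumberField.HeightOneSpectrum.one_lt_absNorm w.maximalIdeal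
    rw [hN, hf, pow_zero] at h1
    exact lt_irrefl _ h1
  unfold residueChar
  rw [hN, Nat.pow_minFac hf, hp.minFac_eq]

/-- **Every rational prime lies below some finite place** (`𝓞 L` is integral over `ℤ`; bookkeeping for the
places "lying over primes `p_i ∈ Primes`", p. 116). [cite: MochizukiFrdI2008, Thm. 6.4 (iii) p.116] -/
theorem exists_residueChar_eq {p : ℕ} (hp : p.Prime) : ∃ w : FinitePlace L, residueChar w = p := by
  haveI : Fact p.Prime := ⟨hp⟩
  obtain ⟨⟨Q, hQ, hQo⟩⟩ := Ideal.nonempty_primesOver (S := 𝓞 L) (span {(p : ℤ)})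
  haveI := hQ
  haveI := hQo
  have hQ0 : Q ≠ ⊥ :=
    Ideal.ne_bot_of_liesOver_of_ne_bot (by simp [hp.ne_zero] : span {(p : ℤ)} ≠ ⊥) Q
  let v : HeightOneSpectrum (𝓞 L) := ⟨Q, hQ, hQ0⟩
  refine ⟨FinitePlace.mk v, ?_⟩
  haveI : (FinitePlace.mk v).maximalIdeal.asIdeal.LiesOver (span {(p : ℤ)}) := by
    rw [FinitePlace.maximalIdeal_mk]; exact hQo
  exact residueChar_eq_of_liesOver hp _

/-- **There are infinitely many finite places** (every rational prime lies below one; used for "there exist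
three nonarchimedean valuations …", p. 116 l. 5–9). [cite: MochizukiFrdI2008, Thm. 6.4 (iii) p.116] -/
theorem infinite_finitePlace : Infinite (FinitePlace L) := by
  by_contra hfin
  rw [not_infinite_iff_finite] at hfin
  have hsub : {p : ℕ | p.Prime} ⊆ Set.range (fun w : FinitePlace L => residueChar w) :=
    fun p hp => exists_residueChar_eq hp
  exact Nat.infinite_setOf_prime ((Set.finite_range _).subset hsub)

/-- **Finitely many places lie over a given rational prime** (the numbers `deg(L_i, v_i)` of p. 116 l. 19
are finite). [cite: MochizukiFrdI2008, Thm. 6.4 (iii) p.116] -/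
theorem placesOver_finite (p : ℕ) : (placesOver L p).Finite := by
  classical
  by_cases hp : p.Prime
  · haveI : Fact p.Prime := ⟨hp⟩
    have hpb : span {(p : ℤ)} ≠ ⊥ := by simp [hp.ne_zero]
    -- inject into the finite set of primes of `𝓞 L` over `(p)`
    let g : FinitePlace L → Ideal (𝓞 L) := fun w => w.maximalIdeal.asIdeal
    have hg : Function.Injective g := fun w₁ w₂ h =>
      FinitePlace.maximalIdeal_injective (HeightOneSpectrum.ext h)
    refine ((IsDedekindDomain.primesOverFinset (span {(p : ℤ)}) (𝓞 L)).finite_toSet.preimage hg.injOn).subset ?_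
    intro w hw
    change residueChar w = p at hw
    change w.maximalIdeal.asIdeal ∈ (IsDedekindDomain.primesOverFinset (span {(p : ℤ)}) (𝓞 L) : Set (Ideal (𝓞 L)))
    rw [Finset.mem_coe, IsDedekindDomain.mem_primesOverFinset_iff hpb]
    haveI := liesOver_residueChar w
    rw [hw] at this
    exact ⟨w.maximalIdeal.isPrime, this⟩
  · convert Set.finite_empty
    ext w
    simp only [placesOver, Set.mem_setOf_eq, Set.mem_empty_iff_false, iff_false]
    exact fun h => hp (h ▸ residueChar_prime w)

end ResidueChar

/-! ### T64iii/L04: three pairs of places with six distinct residue characteristics -/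

/-- Combinatorial core: two functions on an infinite type with finite fibres that never agree take, at
three suitable points, six pairwise distinct values. [folklore] -/
private theorem threePairs_aux {W : Type} [Infinite W] (f g : W → ℕ)
    (hf : ∀ n, {w | f w = n}.Finite) (hg : ∀ n, {w | g w = n}.Finite) (hfg : ∀ w, g w ≠ f w) :
    ∃ w₁ w₃ w₅ : W, [f w₁, g w₁, f w₃, g w₃, f w₅, g w₅].Nodup := by
  classical
  -- avoiding a finite set of values
  have avoid : ∀ T : Finset ℕ, ∃ w, f w ∉ T ∧ g w ∉ T := by
    intro T
    have hfin : {w | f w ∈ T ∨ g w ∈ T}.Finite := by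
      have h1 : {w | f w ∈ T}.Finite := by
        refine (T.finite_toSet.biUnion fun n _ => hf n).subset ?_
        intro w hw; exact Set.mem_biUnion hw rfl
      have h2 : {w | g w ∈ T}.Finite := by
        refine (T.finite_toSet.biUnion fun n _ => hg n).subset ?_
        intro w hw; exact Set.mem_biUnion hw rfl
      exact (h1.union h2).subset fun w hw => hw
    obtain ⟨w, hw⟩ := Infinite.exists_notMem_finset hfin.toFinset
    rw [Set.Finite.mem_toFinset] at hw
    simp only [Set.mem_setOf_eq, not_or] at hw
    exact ⟨w, hw.1, hw.2⟩
  obtain ⟨w₁⟩ := (inferInstance : Nonempty W)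
  obtain ⟨w₃, h3f, h3g⟩ := avoid {f w₁, g w₁}
  obtain ⟨w₅, h5f, h5g⟩ := avoid {f w₁, g w₁, f w₃, g w₃}
  refine ⟨w₁, w₃, w₅, ?_⟩
  simp only [Finset.mem_insert, Finset.mem_singleton, not_or] at h3f h3g h5f h5g
  have h1 := hfg w₁
  have h3 := hfg w₃
  have h5 := hfg w₅
  simp only [List.nodup_cons, List.mem_cons, List.not_mem_nil, List.nodup_nil, or_false,
    not_or, and_true, not_false_eq_true]
  omega

/-- **T64iii/L04** — PROVED. [cite: MochizukiFrdI2008, Thm. 6.4 (iii) p.116] -/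
theorem Thm64iii_L04_threePairs_holds : Thm64iii_L04_threePairs := by
  intro L₁ _ _ L₂ _ _ π hπ
  haveI := infinite_finitePlace (L := L₁)
  refine threePairs_aux (fun w => residueChar w) (fun w => residueChar (π w))
    (fun n => placesOver_finite (L := L₁) n) (fun n => ?_) hπ
  -- `{w | residueChar (π w) = n} = π ⁻¹' placesOver L₂ n`
  exact (placesOver_finite (L := L₂) n).preimage π.injective.injOn

/-! ### Lemma 6.5 (i), two-prime form -/

/-- `a · log p = b · log p'` with `a, b ∈ ℚ`, `a ≠ 0`, `p, p'` prime forces `p = p'` (Lem. 6.5 (i): the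
`log p` are linearly independent over `ℚ`). [cite: MochizukiFrdI2008, Lem. 6.5 (i) p.116] -/
theorem primes_eq_of_rat_mul_log_eq {p p' : ℕ} (hp : p.Prime) (hp' : p'.Prime) {a b : ℚ} (ha : a ≠ 0)
    (h : (a : ℝ) * Real.log p = b * Real.log p') : p = p' := by
  by_contra hne
  have hinj : Function.Injective (![⟨p, hp⟩, ⟨p', hp'⟩] : Fin 2 → Nat.Primes) := by
    intro i j hij
    fin_cases i <;> fin_cases j
    · rfl
    · exact absurd (congrArg Subtype.val hij) hne
    · exact absurd (congrArg Subtype.val hij).symm hne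
    · rfl
  have hli := linearIndependent_rat_log_primes.comp _ hinj
  have hpair : LinearIndependent ℚ ![Real.log p, Real.log p'] := by
    convert hli using 1
    ext i
    fin_cases i <;> rfl
  have := (LinearIndependent.pair_iff.mp hpair) a (-b) (by
    rw [Rat.smul_def, Rat.smul_def, h]; push_cast; ring)
  exact ha this.1

/-! ### T64iii/L06: the numeric core of Theorem 6.4 (iii) -/

/-- **T64iii/L06** — PROVED: from `deg · log N(w₁) = q_w · log N(w₂)` (`q_w ∈ ℚ_{>0}`) along a bijection of
finite places, `deg ∈ ℚ_{>0}` and residue characteristics are preserved. If some pair has equal residue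
characteristic, `deg` is rational and then Lem. 6.5 (i) forces equality everywhere; otherwise T64iii/L04
produces six distinct primes with `log p₁/log p₂ = λ₁ · log p₃/log p₄ = λ₂ · log p₅/log p₆`, `λᵢ ∈ ℚ_{>0}`,
contradicting Lem. 6.5 (ii). [cite: MochizukiFrdI2008, Thm. 6.4 (iii) p.116] -/
theorem Thm64iii_L06_degRational_holds : Thm64iii_L06_degRational := by
  intro L₁ _ _ L₂ _ _ deg π hdeg hrel
  -- unpack the norms: `logNorm w = f_w log p_w`
  have key : ∀ w, ∃ (q : ℚ) (f₁ f₂ : ℕ), 0 < q ∧ f₁ ≠ 0 ∧ f₂ ≠ 0 ∧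
      deg * (f₁ * Real.log (residueChar w)) = q * (f₂ * Real.log (residueChar (π w))) := by
    intro w
    obtain ⟨q, hq, h⟩ := hrel w
    obtain ⟨f₁, hf₁, h₁⟩ := logNorm_eq w
    obtain ⟨f₂, hf₂, h₂⟩ := logNorm_eq (π w)
    exact ⟨q, f₁, f₂, hq, hf₁, hf₂, by rw [← h₁, ← h₂, h]⟩
  have hlogpos : ∀ w : FinitePlace L₁, 0 < Real.log (residueChar w) := fun w =>
    Real.log_pos (by exact_mod_cast (residueChar_prime w).one_lt)
  have hlogpos₂ : ∀ w : FinitePlace L₂, 0 < Real.log (residueChar w) := fun w =>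
    Real.log_pos (by exact_mod_cast (residueChar_prime w).one_lt)
  -- Step 1: if `deg` is rational then every pair has the same residue characteristic
  have step1 : (∃ r : ℚ, 0 < r ∧ deg = r) → ∀ w, residueChar (π w) = residueChar w := by
    rintro ⟨r, hr, rfl⟩ w
    obtain ⟨q, f₁, f₂, hq, hf₁, hf₂, h⟩ := key w
    symm
    refine primes_eq_of_rat_mul_log_eq (residueChar_prime w) (residueChar_prime (π w))
      (a := r * f₁) (b := q * f₂) (mul_ne_zero hr.ne' (Nat.cast_ne_zero.mpr hf₁)) ?_
    push_cast
    linarith [h]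
  -- Step 2: if some pair has equal residue characteristic then `deg` is rational
  have step2 : (∃ w, residueChar (π w) = residueChar w) → ∃ r : ℚ, 0 < r ∧ deg = r := by
    rintro ⟨w, hw⟩
    obtain ⟨q, f₁, f₂, hq, hf₁, hf₂, h⟩ := key w
    rw [hw] at h
    have hl := hlogpos w
    have hf₁' : (0 : ℝ) < f₁ := by exact_mod_cast Nat.pos_of_ne_zero hf₁
    refine ⟨q * f₂ / f₁, by positivity, ?_⟩
    have : deg * f₁ = q * f₂ := by
      have h' : (deg * f₁) * Real.log (residueChar w) = (q * f₂) * Real.log (residueChar w) := by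
        rw [mul_assoc, mul_assoc]; exact h
      exact mul_right_cancel₀ hl.ne' h'
    push_cast
    field_simp
    linarith [this]
  -- Step 3: some pair has equal residue characteristic (else contradict Lem. 6.5 (ii))
  have step3 : ∃ w, residueChar (π w) = residueChar w := by
    by_contra hnone
    push Not at hnone
    obtain ⟨w₁, w₃, w₅, hnodup⟩ := Thm64iii_L04_threePairs_holds L₁ L₂ π hnone
    -- ratios
    have ratio : ∀ w, ∃ r : ℚ, 0 < r ∧
        Real.log (residueChar w) / Real.log (residueChar (π w)) = r / deg := by
      intro w
      obtain ⟨q, f₁, f₂, hq, hf₁, hf₂, h⟩ := key w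
      have hf₁' : (0 : ℝ) < f₁ := by exact_mod_cast Nat.pos_of_ne_zero hf₁
      have hf₂' : (0 : ℝ) < f₂ := by exact_mod_cast Nat.pos_of_ne_zero hf₂
      refine ⟨q * f₂ / f₁, by positivity, ?_⟩
      have hl₂ := hlogpos₂ (π w)
      push_cast
      field_simp
      linarith [h]
    obtain ⟨r₁, hr₁, e₁⟩ := ratio w₁
    obtain ⟨r₃, hr₃, e₃⟩ := ratio w₃
    obtain ⟨r₅, hr₅, e₅⟩ := ratio w₅
    -- the six primes
    let P : Fin 6 → Nat.Primes :=
      ![⟨_, residueChar_prime w₁⟩, ⟨_, residueChar_prime (π w₁)⟩, ⟨_, residueChar_prime w₃⟩,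
        ⟨_, residueChar_prime (π w₃)⟩, ⟨_, residueChar_prime w₅⟩, ⟨_, residueChar_prime (π w₅)⟩]
    have hPinj : Function.Injective P := by
      have hval : (List.ofFn fun i => (P i : ℕ)) =
          [residueChar w₁, residueChar (π w₁), residueChar w₃, residueChar (π w₃), residueChar w₅,
            residueChar (π w₅)] := by
        simp [P, List.ofFn_succ]
      have hnd : (List.ofFn fun i => (P i : ℕ)).Nodup := hval ▸ hnodup
      rw [List.nodup_ofFn] at hnd
      exact fun i j hij => hnd (congrArg Subtype.val hij)
    refine Lemma65ii_holds P hPinj ⟨r₁ / r₃, r₁ / r₅, by positivity, by positivity, ?_, ?_⟩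
    · -- `log p₁/log p₂ = (r₁/r₃) · (log p₃/log p₄)`
      show Real.log (residueChar w₁) / Real.log (residueChar (π w₁)) =
        ((r₁ / r₃ : ℚ) : ℝ) * (Real.log (residueChar w₃) / Real.log (residueChar (π w₃)))
      rw [e₁, e₃]; push_cast; field_simp
    · show ((r₁ / r₃ : ℚ) : ℝ) * (Real.log (residueChar w₃) / Real.log (residueChar (π w₃))) =
        ((r₁ / r₅ : ℚ) : ℝ) * (Real.log (residueChar w₅) / Real.log (residueChar (π w₅)))
      rw [e₃, e₅]; push_cast; field_simp
  exact ⟨step2 step3, step1 (step2 step3)⟩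

end Literature.AlgebraicGeometry.Frobenioids

end
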